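import Mathlib
import Summits.Ventures.HodgeRepro2.T5PadicOpenSubgroups

/-!
# T5PadicLinearTopology — `ℤ_p` is linearly topologised: the ideals `p^k ℤ_p` are a basis at `0`

Cell pub-hodge-repro2, Tier 5 support (seat p7; route/T5-CHECK-G-p7.md §3 S5). Mathlib's evaluation of
power series (`PowerSeries.aeval`, used by p8's T5FiniteZeros and by T5AmiceTransform) asks the target
ring to be linearly topologised (`IsLinearTopology R R`). For Mathlib's `ℤ_[p]` with its norm topology
this instance is not provided by Mathlib; it follows from T5PadicOpenSubgroups: the clopen ideals
`p^k ℤ_p = closedBall 0 p^{-k}` form a basis of the neighbourhoods of `0`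
(`hasBasis_nhds_zero_span_pow`), so `IsLinearTopology.mk_of_hasBasis` applies (`instIsLinearTopology`).
With it every hypothesis of p8's `finite_aevalZeroSet` is satisfied by `ℤ_[p]` (`example` at the end),
which is the model instance of T5FiniteZerosCharacters. Mathlib + T5PadicOpenSubgroups only.
-/

namespace Summit.Ventures.HodgeRepro2.T5PadicLinearTopology

open PadicInt Filter Topology Metric
open Summit.Ventures.HodgeRepro2.T5PadicOpenSubgroups

variable {p : ℕ} [hp : Fact p.Prime]

omit hp in
/-- `p^{-k} = (p⁻¹)^k` in `ℝ`. -/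
theorem zpow_neg_natCast_eq_inv_pow (k : ℕ) : (p : ℝ) ^ (-(k : ℤ)) = ((p : ℝ)⁻¹) ^ k := by
  rw [zpow_neg, zpow_natCast, inv_pow]

/-- The ideals `p^k ℤ_p` (`k ∈ ℕ`) form a basis of the neighbourhoods of `0` in `ℤ_p`
(Mathlib's `Metric.nhds_basis_closedBall_pow` with ratio `p⁻¹`). -/
theorem hasBasis_nhds_zero_span_pow :
    (𝓝 (0 : ℤ_[p])).HasBasis (fun _ : ℕ => True)
      fun k : ℕ => ((Ideal.span {(p : ℤ_[p]) ^ k} : Ideal ℤ_[p]) : Set ℤ_[p]) := by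
  have hp0 : (0 : ℝ) < (p : ℝ)⁻¹ := by
    have := hp.out.pos
    positivity
  have hp1 : (p : ℝ)⁻¹ < 1 := by
    rw [inv_lt_one_iff₀]
    right
    exact_mod_cast hp.out.one_lt
  refine (Metric.nhds_basis_closedBall_pow (x := (0 : ℤ_[p])) hp0 hp1).congr (fun _ => Iff.rfl)
    fun k _ => ?_
  rw [coe_span_pow_eq_closedBall, zpow_neg_natCast_eq_inv_pow]

/-- `ℤ_p` is linearly topologised over itself: its norm topology has the basis of ideals `p^k ℤ_p`
at `0` (the hypothesis `IsLinearTopology R R` of Mathlib's `PowerSeries.aeval`). -/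
instance instIsLinearTopology : IsLinearTopology ℤ_[p] ℤ_[p] :=
  IsLinearTopology.mk_of_hasBasis ℤ_[p] (S := Ideal ℤ_[p]) hasBasis_nhds_zero_span_pow

/-- Sanity: every hypothesis of p8's `finite_aevalZeroSet` (a complete Hausdorff linearly topologised
DVR, adically complete) is satisfied by Mathlib's `ℤ_[p]` with its norm topology. -/
example : IsUniformAddGroup ℤ_[p] ∧ IsTopologicalRing ℤ_[p] ∧ T2Space ℤ_[p] ∧
    CompleteSpace ℤ_[p] ∧ IsLinearTopology ℤ_[p] ℤ_[p] ∧ IsDomain ℤ_[p] ∧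
    IsDiscreteValuationRing ℤ_[p] ∧ IsAdicComplete (IsLocalRing.maximalIdeal ℤ_[p]) ℤ_[p] :=
  ⟨inferInstance, inferInstance, inferInstance, inferInstance, inferInstance,
    inferInstance, inferInstance, inferInstance⟩

end Summit.Ventures.HodgeRepro2.T5PadicLinearTopology
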